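import Mathlib.Dynamics.PeriodicPts.Defs
import Mathlib.Data.Fintype.Card
import Mathlib.Data.List.GetD
import HarnessLib

/-!
# The slice automaticity of MID is exactly `⌊N/2⌋ + 1` (lower bound)

For a language `L ⊆ {0,1}*` and a length `N`, the SLICE AUTOMATICITY `γ_L(N)` is the least number
of states of a deterministic finite automaton over `{0,1}` that is correct on `{0,1}^N` (its
behaviour on other lengths is free); `⌈log₂(γ_L(N)+1)⌉ - 1` is the exact one-pass space that ANY
device (table, circuit, machine) needs at input length `N`.  The levelled Myhill–Nerode profile of
`MID := {x : the ⌈|x|/2⌉-th symbol of x is 1}` has at most two classes per level, yet this file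
proves that every automaton correct on the length-`N` slice of `MID` has at least `⌊N/2⌋ + 1`
states (`card_of_sliceCorrectMID`).  A PHASE GADGET with `⌊N/2⌋ + 1` states is correct for every
`N ≥ 4` (companion file `SoloBlindSliceMIDGadget`: `exists_sliceCorrectMID`, and the two bounds
together `sliceAutomaticity_MID`), so the bound is the exact value there; exhaustive search confirms
`γ_MID(1..18) = 2,3,3,3,3,4,4,5,5,6,6,7,7,8,8,9,9,10`.

PROOF (pumping transfer + descent).  Put `m := ⌈N/2⌉`, `n' := N - m = ⌊N/2⌋` and suppose the
automaton has `s ≤ n'` states; write `f := δ(·,0)`, `g := δ(·,1)`.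
* `pair_contra` — if a prefix `π₁ 0^e` of length `m - 1` ends on a state `f^[e] r` where `r` lies on
  a `0`-cycle of length `L`, and from `p := g (f^[e] r)` some word `u` with `|u| + L ≤ n'` reaches a
  state `x` with `f^[L] x = x`, then the member `π₁ 0^e 1 u 0^L 0^z` and the non-member
  `π₁ 0^(e+L) 1 u 0^z` have the same length `N` and the same final state — absurd.
* `lemmaA` — hence no state of the `0`-cycle through such an `r` is reachable from `p` at all: a
  SHORTEST word `u` from `p` into the cycle visits `|u|` distinct states off the cycle, so
  `|u| + L ≤ s ≤ n'`.
* `descent` — from data `(π, T, p)` with `|π| + T = m`, `δ(q₀, π) = p`, `|Reach p| ≤ T` one builds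
  `p' := g (f^[T-1] p)` with the same data one level down and `|Reach p'| < |Reach p|`
  (`Reach p'` misses the whole `0`-orbit of `p` by `lemmaA`); starting from `([], m, q₀)` this is an
  infinite descent.
The argument is constructive (it yields the fooling pair); written out with every index in the
programme notes `work/s17/proof/gamma_mid_theorem.md`, where its algorithmic form was validated on
341 428 transition tables.  Context: this is PROPOSITION 3.9 (iii) of the soloist report — the
all-device edge of the one-pass window `[ν - 1, ν + log₂(N+1) + 1]` is attained at its UPPER end
up to an additive constant by `MID` (and at its lower end by PARITY); it calibrates that edge and
claims nothing on the summit line.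

References (automaticity, the `≤ N` variant): J. Shallit, Y. Breitbart, Automaticity I,
J. Comput. Syst. Sci. 53 (1996); J.-P. Allouche, J. Shallit, Automatic Sequences (CUP 2003) §15.1;
R. M. Karp, Some bounds on the storage requirements of sequential machines and Turing machines,
J. ACM 14 (1967) (online state complexity).
-/

namespace Summit.PneNP.PneNP.Theorems.SoloBlind

open Function Finset

section SliceMID

variable {σ : Type*} (δ : σ → Bool → σ)

/-- The run of the automaton `δ` from state `q` on the word `w`. -/
def run (q : σ) (w : List Bool) : σ := w.foldl δ q

/-- The run on the empty word. -/
@[simp] theorem run_nil (q : σ) : run δ q [] = q := rfl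

/-- The run on `b :: w`: one transition, then the run on `w`. -/
@[simp] theorem run_cons (q : σ) (b : Bool) (w : List Bool) :
    run δ q (b :: w) = run δ (δ q b) w := rfl

/-- The run on a concatenation. -/
theorem run_append (q : σ) (u v : List Bool) :
    run δ q (u ++ v) = run δ (run δ q u) v := List.foldl_append

/-- The run on `0^k` is the `k`-th iterate of `δ(·,0)`. -/
theorem run_replicate_false (q : σ) (k : ℕ) :
    run δ q (List.replicate k false) = (fun x => δ x false)^[k] q := by
  induction k generalizing q with
  | zero => rfl
  | succ k ih =>
    rw [List.replicate_succ, run_cons, ih, Function.iterate_succ_apply]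

/-- `δ, q₀, F` is correct on the length-`N` slice of `MID`: a word of length `N` is accepted iff its
`⌈N/2⌉`-th symbol (`0`-indexed position `(N+1)/2 - 1`) is `1`. -/
def SliceCorrectMID (q₀ : σ) (F : Set σ) (N : ℕ) : Prop :=
  ∀ x : List Bool, x.length = N → (run δ q₀ x ∈ F ↔ x.getD ((N + 1) / 2 - 1) false = true)

variable {δ}

/-- Periodicity along a `0`-orbit: `f^[c+d] p = f^[c] p` propagates to all later times. -/
theorem iterate_periodic (f : σ → σ) (p : σ) {c d : ℕ} (h : f^[c + d] p = f^[c] p) :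
    ∀ k t, c ≤ t → f^[t + k * d] p = f^[t] p := by
  have step : ∀ t, c ≤ t → f^[t + d] p = f^[t] p := by
    intro t ht
    obtain ⟨i, rfl⟩ := Nat.exists_eq_add_of_le ht
    rw [show c + i + d = i + (c + d) by omega, Function.iterate_add_apply, h,
      ← Function.iterate_add_apply, Nat.add_comm]
  intro k
  induction k with
  | zero => intro t _; simp
  | succ k ih =>
    intro t ht
    have hkd : c ≤ t + k * d := le_trans ht (Nat.le_add_right _ _)
    rw [Nat.add_mul, Nat.one_mul, ← Nat.add_assoc, step _ hkd, ih t ht]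

/-- PUMPING TRANSFER.  A `0`-loop of length `L` available before the decisive symbol (at the state
`r`, `f^[L] r = r`) trades against a `0`-loop of the same length after it (at `x`, reached from
`p = g (f^[e] r)` by `u`, provided `|u| + L` fits into the `n'` symbols after the decisive one):
the member `π₁ 0^e 1 u 0^L 0^z` and the non-member `π₁ 0^(e+L) 1 u 0^z` then end in the same
state.  So a slice-correct automaton admits no such configuration. -/
theorem pair_contra {q₀ : σ} {F : Set σ} {N m n' : ℕ} (hD : SliceCorrectMID δ q₀ F N)
    (hmdef : m = (N + 1) / 2) (hmn : m + n' = N) (hm1 : 1 ≤ m)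
    (π₁ u : List Bool) (e L : ℕ) (hlen : π₁.length + e = m - 1) (hL : 1 ≤ L)
    (hr : (fun x => δ x false)^[L] (run δ q₀ π₁) = run δ q₀ π₁)
    (hx : (fun x => δ x false)^[L]
        (run δ (δ ((fun x => δ x false)^[e] (run δ q₀ π₁)) true) u)
      = run δ (δ ((fun x => δ x false)^[e] (run δ q₀ π₁)) true) u)
    (hfit : u.length + L ≤ n') : False := by
  set f : σ → σ := fun x => δ x false with hf
  set r := run δ q₀ π₁ with hrdef
  set x := run δ (δ (f^[e] r) true) u with hxdef
  obtain ⟨L', rfl⟩ : ∃ L', L = L' + 1 := ⟨L - 1, by omega⟩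
  set z := n' - u.length - (L' + 1) with hz
  -- the common prefix of length `m - 1`
  set P := π₁ ++ List.replicate e false with hP
  have hPlen : P.length = m - 1 := by simp [hP, hlen]
  have hPrun : run δ q₀ P = f^[e] r := by
    rw [hP, run_append, run_replicate_false]
  -- the member word
  set A := P ++ (true :: (u ++ List.replicate (L' + 1) false ++ List.replicate z false)) with hA
  -- the non-member word
  set B := P ++ (List.replicate (L' + 1) false ++ (true :: (u ++ List.replicate z false))) with hB
  have hAlen : A.length = N := by
    simp [hA, hPlen]; omega
  have hBlen : B.length = N := by
    simp [hB, hPlen]; omega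
  have hAm : A.getD ((N + 1) / 2 - 1) false = true := by
    rw [← hmdef, hA, List.getD_append_right _ _ _ _ (by omega), hPlen, Nat.sub_self]
    simp
  have hBm : B.getD ((N + 1) / 2 - 1) false = false := by
    rw [← hmdef, hB, List.getD_append_right _ _ _ _ (by omega), hPlen, Nat.sub_self]
    simp [List.replicate_succ]
  have hArun : run δ q₀ A = run δ x (List.replicate z false) := by
    rw [hA, run_append, hPrun, run_cons, run_append, run_append, ← hxdef,
      run_replicate_false δ x (L' + 1), ← hf, hx]
  have hBrun : run δ q₀ B = run δ x (List.replicate z false) := by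
    have : f^[L' + 1] (f^[e] r) = f^[e] r := by
      rw [← Function.iterate_add_apply, Nat.add_comm, Function.iterate_add_apply, hr]
    rw [hB, run_append, hPrun, run_append, run_replicate_false δ (f^[e] r) (L' + 1), ← hf,
      this, run_cons, run_append, ← hxdef]
  have h1 := (hD A hAlen).mpr hAm
  have h2 : run δ q₀ B ∉ F := fun hBF => by
    have h := (hD B hBlen).mp hBF
    rw [hBm] at h
    exact Bool.false_ne_true h
  exact h2 (hBrun ▸ hArun ▸ h1)

/-- LEMMA A.  In a slice-correct automaton with at most `n'` states: if a prefix `π₁ 0^e` of length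
`m - 1` passes through a `0`-periodic state `r = δ(q₀, π₁)`, then NO state of the `0`-cycle of `r` is
reachable from `p = g (f^[e] r)` — a shortest word into the cycle would fit (`pair_contra`). -/
theorem lemmaA [Fintype σ] {q₀ : σ} {F : Set σ} {N m n' : ℕ} (hD : SliceCorrectMID δ q₀ F N)
    (hmdef : m = (N + 1) / 2) (hmn : m + n' = N) (hm1 : 1 ≤ m) (hs : Fintype.card σ ≤ n')
    (π₁ : List Bool) (e : ℕ) (hlen : π₁.length + e = m - 1)
    (hper : 0 < minimalPeriod (fun x => δ x false) (run δ q₀ π₁)) :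
    ∀ j : ℕ, ∀ w : List Bool,
      run δ (δ ((fun x => δ x false)^[e] (run δ q₀ π₁)) true) w
        ≠ (fun x => δ x false)^[j] (run δ q₀ π₁) := by
  classical
  set f : σ → σ := fun x => δ x false with hf
  set r := run δ q₀ π₁ with hrdef
  set p := δ (f^[e] r) true with hpdef
  set L := minimalPeriod f r with hLdef
  have hrL : f^[L] r = r := iterate_minimalPeriod
  intro j₀ w₀ hw₀
  -- a shortest word from `p` into the cycle of `r`
  have hex : ∃ k, ∃ u : List Bool, u.length = k ∧ ∃ j, run δ p u = f^[j] r :=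
    ⟨w₀.length, w₀, rfl, j₀, hw₀⟩
  let k := Nat.find hex
  obtain ⟨u, huk, j, huj⟩ : ∃ u : List Bool, u.length = k ∧ ∃ j, run δ p u = f^[j] r :=
    Nat.find_spec hex
  have hmin : ∀ k' < k, ¬ ∃ u : List Bool, u.length = k' ∧ ∃ j, run δ p u = f^[j] r :=
    fun k' hk' => Nat.find_min hex hk'
  have hxL : f^[L] (run δ p u) = run δ p u := by
    rw [huj, ← Function.iterate_add_apply, Nat.add_comm, Function.iterate_add_apply, hrL]
  -- the states along `u` before the end: pairwise distinct and off the cycle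
  let st : ℕ → σ := fun i => run δ p (u.take i)
  have st_off : ∀ i < k, ∀ i', st i ≠ f^[i'] r := by
    intro i hi i' h
    exact hmin i hi ⟨u.take i, by simp [huk]; omega, i', h⟩
  -- cutting out the segment between two visits of one state gives a shorter word
  have key : ∀ a b : ℕ, b < k → a < b → st a = st b → False := by
    intro a b hb hab h
    have hcut : run δ p (u.take a ++ u.drop b) = f^[j] r := by
      rw [run_append, show run δ p (u.take a) = st a from rfl, h,
        show st b = run δ p (u.take b) from rfl, ← run_append, List.take_append_drop, huj]
    refine hmin (a + (k - b)) (by omega) ⟨u.take a ++ u.drop b, ?_, j, hcut⟩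
    simp [huk]; omega
  have st_inj : Set.InjOn st (Finset.range k : Set ℕ) := by
    intro i hi i₂ hi₂ h
    simp only [Finset.coe_range, Set.mem_Iio] at hi hi₂
    by_contra hne
    rcases lt_or_gt_of_ne hne with hlt | hlt
    · exact key i i₂ hi₂ hlt h
    · exact key i₂ i hi hlt h.symm
  -- count: the `k` states `st i` and the `L` cycle states are distinct elements of `σ`
  set S : Finset σ := (Finset.range k).image st with hS
  set C : Finset σ := (Finset.range L).image (fun i => f^[i] r) with hC
  have hScard : S.card = k := by
    rw [hS, Finset.card_image_of_injOn st_inj, Finset.card_range]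
  have hCcard : C.card = L := by
    rw [hC, Finset.card_image_of_injOn, Finset.card_range]
    intro i hi i₂ hi₂ h
    simp only [Finset.coe_range, Set.mem_Iio] at hi hi₂
    exact (iterate_eq_iterate_iff_of_lt_minimalPeriod hi hi₂).mp h
  have hdisj : Disjoint S C := by
    rw [Finset.disjoint_left]
    intro y hyS hyC
    rw [hS, Finset.mem_image] at hyS
    rw [hC, Finset.mem_image] at hyC
    obtain ⟨i, hi, rfl⟩ := hyS
    obtain ⟨i', _, hi'⟩ := hyC
    exact st_off i (by simpa using hi) i' hi'.symm
  have hcount : k + L ≤ Fintype.card σ := by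
    rw [← hScard, ← hCcard, ← Finset.card_union_of_disjoint hdisj]
    exact Finset.card_le_univ _
  -- so the shortest word fits after the decisive symbol: contradiction
  exact pair_contra hD hmdef hmn hm1 π₁ u e L hlen hper hrL hxL (by omega)

/-- The states reachable from `p`. -/
noncomputable def reach [Fintype σ] (p : σ) : Finset σ := by
  classical exact Finset.univ.filter (fun x => ∃ w, run δ p w = x)

/-- Membership in `reach`. -/
theorem mem_reach [Fintype σ] {p x : σ} : x ∈ reach (δ := δ) p ↔ ∃ w, run δ p w = x := by
  classical
  unfold reach; simp

/-- Every run from `p` ends in `reach p`. -/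
theorem run_mem_reach [Fintype σ] (p : σ) (w : List Bool) : run δ p w ∈ reach (δ := δ) p :=
  mem_reach.mpr ⟨w, rfl⟩

/-- `p ∈ reach p`. -/
theorem self_mem_reach [Fintype σ] (p : σ) : p ∈ reach (δ := δ) p := run_mem_reach p []

/-- `reach` is transitive. -/
theorem reach_subset_of_mem [Fintype σ] {p x : σ} (hx : x ∈ reach (δ := δ) p) :
    reach (δ := δ) x ⊆ reach (δ := δ) p := by
  intro y hy
  obtain ⟨w, rfl⟩ := mem_reach.mp hx
  obtain ⟨w', rfl⟩ := mem_reach.mp hy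
  exact mem_reach.mpr ⟨w ++ w', run_append _ _ _ _⟩

/-- The `0`-orbit of `p`. -/
noncomputable def orb [Fintype σ] (p : σ) : Finset σ := by
  classical exact Finset.univ.filter (fun x => ∃ j, (fun x => δ x false)^[j] p = x)

/-- Membership in `orb`. -/
theorem mem_orb [Fintype σ] {p x : σ} :
    x ∈ orb (δ := δ) p ↔ ∃ j, (fun x => δ x false)^[j] p = x := by
  classical
  unfold orb; simp

/-- The `0`-orbit is reachable. -/
theorem orb_subset_reach [Fintype σ] (p : σ) : orb (δ := δ) p ⊆ reach (δ := δ) p := by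
  intro x hx
  obtain ⟨j, rfl⟩ := mem_orb.mp hx
  rw [← run_replicate_false]
  exact run_mem_reach _ _

/-- Pigeonhole on a `0`-orbit: it becomes periodic within its own cardinality. -/
theorem exists_period [Fintype σ] (p : σ) :
    ∃ c d, 1 ≤ d ∧ c + d ≤ (orb (δ := δ) p).card ∧
      (fun x => δ x false)^[c + d] p = (fun x => δ x false)^[c] p := by
  classical
  set f : σ → σ := fun x => δ x false with hf
  set n := (orb (δ := δ) p).card with hn
  have hmaps : Set.MapsTo (fun j : ℕ => f^[j] p) (Finset.range (n + 1) : Set ℕ)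
      (orb (δ := δ) p : Set σ) := by
    intro j _
    simp only [Finset.mem_coe]
    exact mem_orb.mpr ⟨j, rfl⟩
  obtain ⟨i, hi, j, hj, hij, hfij⟩ :=
    Finset.exists_ne_map_eq_of_card_lt_of_maps_to (s := Finset.range (n + 1))
      (t := orb (δ := δ) p) (by simp [hn]) hmaps
  simp only [Finset.mem_range] at hi hj
  rcases lt_or_gt_of_ne hij with hlt | hlt
  · exact ⟨i, j - i, by omega, by omega, by rw [show i + (j - i) = j by omega]; exact hfij.symm⟩
  · exact ⟨j, i - j, by omega, by omega, by rw [show j + (i - j) = i by omega]; exact hfij⟩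

/-- DESCENT.  There are no data `(π, T, p)` with `|π| + T = m`, `δ(q₀, π) = p` and `|Reach p| ≤ T`
(by induction on `|Reach p|`): the next generator `p' = g (f^[T-1] p)` carries the same data one
level down and reaches strictly fewer states, because by `lemmaA` it cannot reach the `0`-orbit of
`p`. -/
theorem descent [Fintype σ] {q₀ : σ} {F : Set σ} {N m n' : ℕ} (hD : SliceCorrectMID δ q₀ F N)
    (hmdef : m = (N + 1) / 2) (hmn : m + n' = N) (hm1 : 1 ≤ m) (hs : Fintype.card σ ≤ n') :
    ∀ n : ℕ, ∀ T : ℕ, ∀ π : List Bool, ∀ p : σ, (reach (δ := δ) p).card ≤ n →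
      π.length + T = m → run δ q₀ π = p → (reach (δ := δ) p).card ≤ T → False := by
  classical
  set f : σ → σ := fun x => δ x false with hf
  intro n
  induction n with
  | zero =>
    intro T π p hn _ _ _
    have : p ∈ reach (δ := δ) p := self_mem_reach p
    have : 0 < (reach (δ := δ) p).card := Finset.card_pos.mpr ⟨p, this⟩
    omega
  | succ n ih =>
    intro T π p hn hπT hπp hT
    obtain ⟨c, d, hd, hcd, hper⟩ := exists_period (δ := δ) p
    have horb : (orb (δ := δ) p).card ≤ (reach (δ := δ) p).card :=
      Finset.card_le_card (orb_subset_reach p)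
    have hcdT : c + d ≤ T := by omega
    -- the periodic state `r₁ = f^[c] p` and the prefix `π ++ 0^c`
    set r₁ := f^[c] p with hr₁
    have hr₁per : f^[d] r₁ = r₁ := by
      rw [hr₁, ← Function.iterate_add_apply, Nat.add_comm, hper]
    have hminpos : 0 < minimalPeriod f r₁ :=
      IsPeriodicPt.minimalPeriod_pos hd hr₁per
    set π₁ := π ++ List.replicate c false with hπ₁
    have hπ₁run : run δ q₀ π₁ = r₁ := by
      rw [hπ₁, run_append, hπp, run_replicate_false]
    set e := T - 1 - c with he
    have hlen : π₁.length + e = m - 1 := by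
      simp [hπ₁]; omega
    -- the next generator
    set p' := δ (f^[T - 1] p) true with hp'
    have hp'e : p' = δ (f^[e] r₁) true := by
      rw [hp', hr₁, ← Function.iterate_add_apply, show e + c = T - 1 by omega]
    -- Lemma A: nothing on the cycle of `r₁` is reachable from `p'`
    have hA := lemmaA hD hmdef hmn hm1 hs π₁ e hlen (by rw [hπ₁run]; exact hminpos)
    -- hence `reach p'` misses the whole `0`-orbit of `p`
    have hmiss : Disjoint (reach (δ := δ) p') (orb (δ := δ) p) := by
      rw [Finset.disjoint_left]
      intro y hy hyo
      obtain ⟨w, hw⟩ := mem_reach.mp hy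
      obtain ⟨i, hi⟩ := mem_orb.mp hyo
      apply hA i (w ++ List.replicate c false)
      rw [hπ₁run, ← hp'e, run_append, hw, run_replicate_false, ← hf, ← hi, hr₁,
        ← Function.iterate_add_apply, ← Function.iterate_add_apply, Nat.add_comm]
    -- and `reach p' ⊆ reach p`
    have hsub : reach (δ := δ) p' ⊆ reach (δ := δ) p := by
      apply reach_subset_of_mem
      refine mem_reach.mpr ⟨List.replicate (T - 1) false ++ [true], ?_⟩
      rw [run_append, run_replicate_false, ← hf, run_cons, run_nil]
    have hcard : (reach (δ := δ) p').card + (orb (δ := δ) p).card ≤ (reach (δ := δ) p).card := by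
      rw [← Finset.card_union_of_disjoint hmiss]
      exact Finset.card_le_card (Finset.union_subset hsub (orb_subset_reach p))
    have horbpos : 0 < (orb (δ := δ) p).card :=
      Finset.card_pos.mpr ⟨p, mem_orb.mpr ⟨0, rfl⟩⟩
    -- how many full turns of the cycle fit before the decisive symbol
    obtain ⟨K, hK⟩ : ∃ K, K = (T - 1 - c) / d := ⟨_, rfl⟩
    have hKle : K * d ≤ T - 1 - c := hK ▸ Nat.div_mul_le_self _ _
    have hKlt : T - 1 - c < K * d + d := hK ▸ Nat.lt_div_mul_add hd
    obtain ⟨Kd, hKd⟩ : ∃ Kd, Kd = K * d := ⟨_, rfl⟩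
    rw [← hKd] at hKle hKlt
    by_cases hK0 : Kd = 0
    · -- no full turn fits: then the orbit of `p` exhausts `reach p` and `reach p'` is empty
      have h0 : (reach (δ := δ) p').card = 0 := by omega
      have hne : p' ∈ reach (δ := δ) p' := self_mem_reach p'
      rw [Finset.card_eq_zero] at h0
      rw [h0] at hne
      exact absurd hne (Finset.notMem_empty _)
    · -- descend
      refine ih Kd (π ++ List.replicate (T - 1 - Kd) false ++ [true]) p' (by omega)
        ?_ ?_ (by omega)
      · simp; omega
      · rw [run_append, run_append, hπp, run_replicate_false, ← hf, run_cons, run_nil, hp']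
        congr 1
        have hP := iterate_periodic f p hper K (T - 1 - Kd) (by omega)
        rw [← hKd, show T - 1 - Kd + Kd = T - 1 by omega] at hP
        exact hP.symm

/-- THEOREM (slice automaticity of MID, lower bound).  Every automaton correct on the length-`N`
slice of `MID` has at least `⌊N/2⌋ + 1` states.  (A phase gadget attains this for all `N ≥ 4`.) -/
theorem card_of_sliceCorrectMID [Fintype σ] {q₀ : σ} {F : Set σ} {N : ℕ}
    (hD : SliceCorrectMID δ q₀ F N) : N / 2 + 1 ≤ Fintype.card σ := by
  classical
  by_contra hlt
  rw [not_le] at hlt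
  have hpos : 0 < Fintype.card σ := Fintype.card_pos_iff.mpr ⟨q₀⟩
  set m := (N + 1) / 2 with hm
  have hmn : m + N / 2 = N := by omega
  have hm1 : 1 ≤ m := by omega
  have hs : Fintype.card σ ≤ N / 2 := by omega
  refine descent hD hm hmn hm1 hs (reach (δ := δ) q₀).card m [] q₀ le_rfl (by simp) rfl ?_
  exact (Finset.card_le_univ _).trans (by omega)

end SliceMID

end Summit.PneNP.PneNP.Theorems.SoloBlind
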